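import Summits.BirchSwinnertonDyer.BirchSwinnertonDyer.Theorems.ResidualThetaTransportAtTwoThetaLayerLambdaCongruenceAtTwoStarBridge
import Summits.BirchSwinnertonDyer.BirchSwinnertonDyer.Theorems.ResidualThetaTransportAtTwoThetaLayerLambdaCongruenceAtTwoStarOddIsogeny
import Summits.BirchSwinnertonDyer.BirchSwinnertonDyer.Theorems.ResidualThetaTransportAtTwoThetaLayerLambdaCongruenceAtTwoStarDepletedForm
import Literature.NumberTheory.EllipticCurves.RealPeriodProofs
import Literature.NumberTheory.EllipticCurves.CuspFormLFunction
import HarnessLib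

/-!
# Crux `ThetaLayerLambdaCongruenceAtTwo` (stmt-BirchSwinnertonDyer-20688, route ResidualThetaTransportAtTwo), line
# `birth` v9, stub (C3k), plan ITEM B5 — ASSEMBLY, fact-free layer: complex conjugation is NOT the identity on
# `H₁(X₀(L), ℤ)/𝔪` for the eigen-ideal of the `S`-depleted newform of `W` (`Δ_W < 0`, `W` good supersingular at
# `2`), GIVEN the optimal quotient `A` of `J₀(L)` attached to the depleted form and a cyclic `ℚ`-isogeny `W → A`
# (width seat bsd-wall-rtt-p3-w3 g3; `--supports stmt-BirchSwinnertonDyer-20688 --as helper`; closes nothing)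

HONEST FRAMING. A THEOREM with NO named fact: the two arithmetic existence statements it consumes — (H1) the
optimal quotient `A = J₀(L)/I_g J₀(L)` is an elliptic curve over `ℚ` with Néron lattice `c·Λ_g`, `c ∈ ℚ^×`
(Literature fact `eichlerShimura_optimalQuotient_periodLattice`, Knapp Thm. 11.74 / Agashe–Ribet–Stein §2–3 — in
review as p598085 when this file was written), and (H1') a CYCLIC `ℚ`-isogeny `W → A` (from `W ~ A` by Faltings,
`isIsogenous_iff_frobeniusTrace_eq`, and Mazur–Kenku, `mazurKenku_exists_cyclic_isogeny`) — enter as explicit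
DATA (`A`, `L_A`, `c`, `ψ`). The sibling layer that discharges them from the three named facts follows once p598085
lands. Nothing here proves (C3k) or the crux; BSD is not proved by any of this.

WHAT (`exists_periodFunctional_iotaConj_add_notMem_of_optimalQuotient`). Data: `W/ℚ` globally minimal, `GoodSS W 2`,
`Δ_W < 0`; a cusp form `g ∈ S₂(Γ₀(L))` with real coefficients (the depleted eigenform of `…StarDepletedForm`); an
elliptic `A/ℚ` with a Néron period pair `L_A` and `c ∈ ℚ^×` such that `Λ_A = c·Λ_g`; a cyclic `ℚ`-isogeny
`ψ : W → A`. Conclusion: for EVERY ideal `𝔪 ⊆ HeckeRing0 L 2` acting on `g` by even integers there is `γ ∈ Γ₀(L)`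
with `{∞,(εγε)∞} + {∞,γ∞} ∉ 𝔪 • Λ` (ITEM B5: `c ≠ 1` on `Λ/𝔪Λ`; in particular `𝔪Λ ≠ Λ`). Chain:
`…StarOddIsogeny.exists_real_oddIndex_latticeBridge_of_goodSS_two` (odd degree, real multiplier `αΛ_W ⊆ Λ_A`,
`m·Λ_A ⊆ αΛ_W`) ⟶ `…StarBridge` ⟶ `…StarEigenform`. Also `ideal_span_acts_even` (§1): the explicit eigen-ideal
`𝔪₀ = (2, T_p − a_p(f)·1 (p ∉ S), T_ℓ (ℓ ∈ S))` of the depleted form acts on it by even integers, and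
`exists_depleted_eigenform_of_isNewformOf` (§1): the depleted form of the newform of `W` at level `N_f·∏_{ℓ∈S} ℓ²`.

References: [CremonaAlgorithms1997] §2.6, §2.10; [Knapp1993] Thm. 11.74; [AgasheRibetStein2006] §2–3;
[SilvermanAEC2009] VI.4.1, VI.5.3; [AtkinLehner1970] §3.
-/

noncomputable section

-- justification: the `Summit.BirchSwinnertonDyer.BirchSwinnertonDyer.…` path repeats a component (route-file convention)
set_option linter.dupNamespace false

open scoped MatrixGroups ComplexConjugate ModularForm

open CongruenceSubgroup Complex WeierstrassCurve
open Literature.NumberTheory.EllipticCurves Literature.NumberTheory.EllipticCurves.ModularForms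
open Literature.NumberTheory.EllipticCurves.Rank1Residual

namespace Summit.BirchSwinnertonDyer.BirchSwinnertonDyer.Theorems.ThetaLayerLambdaCongruenceAtTwo

/-! ## §1. The depleted newform of `W` and its explicit eigen-ideal -/

section Depleted

/-- **The depleted form of the newform of `W`.** For `W/ℚ` with newform `f ∈ S₂(Γ₀(N))` (`IsNewformOf W f`) and a
finite set `S` of primes, at level `L = N·∏_{ℓ∈S} ℓ²` there is `g` with integer/real coefficients, `a₁(g) = 1`,
`a_n(g) = 𝟙_{(n,S)=1} a_n(W)`, `T_p g = a_p(W) g` (`p ∉ S`), `U_ℓ g = 0` (`ℓ ∈ S`), `T_p g = a_p(g) g` for all `p`.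
[cite: AtkinLehner1970, §3] -/
theorem exists_depleted_eigenform_of_isNewformOf (W : WeierstrassCurve ℚ) {N : ℕ} [NeZero N]
    {f : CuspForm (Gamma0 N) 2} (hf : IsNewformOf W f) (S : Finset ℕ) (hS : ∀ ℓ ∈ S, ℓ.Prime) (L : ℕ) [NeZero L]
    (hL : L = N * ∏ ℓ ∈ S, ℓ ^ 2) :
    ∃ g : CuspForm (Gamma0 L) 2,
      (∀ n : ℕ, cuspCoeff g n = if ∃ ℓ ∈ S, ℓ ∣ n then 0 else (W.LFunction n : ℂ)) ∧
      (∀ n : ℕ, ∃ z : ℤ, cuspCoeff g n = z) ∧ (∀ n : ℕ, (cuspCoeff g n).im = 0) ∧ cuspCoeff g 1 = 1 ∧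
      (∀ (p : ℕ) (hp : p.Prime), p ∉ S →
        (haveI : NeZero p := ⟨hp.ne_zero⟩; heckeT (Gamma0 L) 2 p g) = (W.LFunction p : ℂ) • g) ∧
      (∀ (ℓ : ℕ) (hℓ : ℓ.Prime), ℓ ∈ S → (haveI : NeZero ℓ := ⟨hℓ.ne_zero⟩; heckeT (Gamma0 L) 2 ℓ g) = 0) ∧
      (∀ (p : ℕ) (hp : p.Prime), (haveI : NeZero p := ⟨hp.ne_zero⟩; heckeT (Gamma0 L) 2 p g) = cuspCoeff g p • g) := by
  have hint : ∀ n : ℕ, ∃ z : ℤ, cuspCoeff f n = z := fun n ↦ ⟨W.LFunction n, hf.2 n⟩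
  have h1 : cuspCoeff f 1 = 1 := hf.1.2.2
  have hT : ∀ (p : ℕ) (hp : p.Prime), (haveI : NeZero p := ⟨hp.ne_zero⟩; heckeT (Gamma0 N) 2 p f) =
      cuspCoeff f p • f := fun p hp ↦ by
    haveI : NeZero p := ⟨hp.ne_zero⟩
    exact hf.1.heckeT_eq_coeff_smul hp
  obtain ⟨g, hg, hgi, hgr, hg1, hgT, hgU, hgall⟩ := exists_depleted_eigenform f hint h1 hT S hS L hL
  refine ⟨g, fun n ↦ by rw [hg n, hf.2 n], hgi, hgr, hg1, fun p hp hpS ↦ by rw [hgT p hp hpS, hf.2 p], hgU, hgall⟩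

/-- **An explicit eigen-ideal acts on its eigenform by even integers.** For `g ∈ S₂(Γ₀(L))` with
`T_p g = b_p g`, `b_p ∈ ℤ`, for every prime `p` (for the depleted form of `…StarDepletedForm`: `b_p = a_p(W)` off `S`,
`b_ℓ = 0` on `S`), every element of an ideal generated by `2` and elements `T_p − b_p` acts on `g` by an even
integer — the hypothesis `h𝔪` of the B5 spine. [folklore] -/
theorem ideal_span_acts_even {L : ℕ} [NeZero L] (g : CuspForm (Gamma0 L) 2) (b : ℕ → ℤ)
    (hb : ∀ (p : ℕ) (hp : p.Prime), (haveI : NeZero p := ⟨hp.ne_zero⟩; heckeT (Gamma0 L) 2 p g) = ((b p : ℤ) : ℂ) • g)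
    (G : Set (HeckeRing0 L 2))
    (hG : G ⊆ {t | t = 2 ∨ ∃ (p : ℕ) (hp : p.Prime), t = HeckeRing0.T L 2 p hp - (b p : HeckeRing0 L 2)}) :
    ∀ t ∈ Ideal.span G, ∃ e : ℤ, HeckeRing0.toEnd L 2 t g = ((2 * e : ℤ) : ℂ) • g := by
  have hall : ∀ t : HeckeRing0 L 2, ∃ a : ℤ, HeckeRing0.toEnd L 2 t g = (a : ℂ) • g :=
    forall_mem_heckeRing0_exists_int g fun p hp ↦ ⟨b p, hb p hp⟩
  refine forall_mem_span_exists_even g hall fun s hs ↦ ?_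
  rcases hG hs with rfl | ⟨p, hp, rfl⟩
  · refine ⟨1, ?_⟩
    rw [map_ofNat, Module.End.ofNat_apply, mul_one, Int.cast_ofNat, ← Nat.cast_smul_eq_nsmul ℂ, Nat.cast_ofNat]
  · refine ⟨0, ?_⟩
    rw [map_sub, map_intCast, LinearMap.sub_apply, HeckeRing0.toEnd_T, hb p hp, Module.End.intCast_apply,
      Int.cast_smul_eq_zsmul, sub_self, mul_zero, Int.cast_zero, zero_smul]

end Depleted

/-! ## §2. ITEM B5 given the optimal quotient and a cyclic isogeny -/

section Assembly

/-- A Néron period pair of `W ⊗ ℂ` exists (`exists_periodPair_realPeriod_eq_holds` on `W ⊗ ℝ`, read over `ℂ`).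
[cite: SilvermanAEC2009, Thm. VI.5.1] -/
theorem exists_isNeronLatticeOf (W : WeierstrassCurve ℚ) [W.IsElliptic] :
    ∃ L : PeriodPair, IsNeronLatticeOf (W.baseChange ℂ) L := by
  haveI hWℝ : (W.baseChange ℝ).IsElliptic := by rw [WeierstrassCurve.baseChange]; infer_instance
  obtain ⟨L, hL₂, hL₃, -⟩ := (W.baseChange ℝ).exists_periodPair_realPeriod_eq_holds
  have hc₄ : (((W.baseChange ℝ).c₄ : ℝ) : ℂ) = (W.baseChange ℂ).c₄ := by
    rw [WeierstrassCurve.baseChange, WeierstrassCurve.baseChange, map_c₄, map_c₄, ofReal_algebraMap_eq]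
  have hc₆ : (((W.baseChange ℝ).c₆ : ℝ) : ℂ) = (W.baseChange ℂ).c₆ := by
    rw [WeierstrassCurve.baseChange, WeierstrassCurve.baseChange, map_c₆, map_c₆, ofReal_algebraMap_eq]
  refine ⟨L, ?_, ?_⟩
  · rw [hL₂, ← hc₄]; push_cast; ring
  · rw [hL₃, ← hc₆]; push_cast; ring

/-- **ITEM B5, assembled modulo the optimal quotient and a cyclic isogeny.** `W/ℚ` globally minimal, good
supersingular at `2`, `Δ_W < 0`; `g ∈ S₂(Γ₀(L))` with real coefficients; an elliptic `A/ℚ` with Néron period pair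
`L_A` and `c ∈ ℚ^×` such that `Λ_A = c·Λ_g` (the optimal quotient attached to `g`); a cyclic `ℚ`-isogeny `ψ : W → A`.
Then for every ideal `𝔪 ⊆ 𝕋 = HeckeRing0 L 2` acting on `g` by even integers, complex conjugation is not the
identity on `Λ/𝔪Λ`: some `γ ∈ Γ₀(L)` has `{∞,(εγε)∞} + {∞,γ∞} ∉ 𝔪 • Λ`.
[cite: CremonaAlgorithms1997, §2.10 (pp. 29–30)] -/
theorem exists_periodFunctional_iotaConj_add_notMem_of_optimalQuotient (W : WeierstrassCurve ℚ) [W.IsElliptic]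
    [W.IsGloballyMinimal] (hss : GoodSS W 2) (hΔ : W.Δ < 0) {L : ℕ} [NeZero L] (g : CuspForm (Gamma0 L) 2)
    (hreal : ∀ n, (cuspCoeff g n).im = 0)
    (A : WeierstrassCurve ℚ) [A.IsElliptic] {LA : PeriodPair} (hLA : IsNeronLatticeOf (A.baseChange ℂ) LA)
    {c : ℚ} (hc : c ≠ 0) (hlat : ∀ z : ℂ, z ∈ LA.lattice ↔ ∃ w ∈ periodLattice g, z = (c : ℂ) * w)
    (ψ : Isogeny W A) (hcyc : ψ.IsCyclic)
    (𝔪 : Ideal (HeckeRing0 L 2)) (h𝔪 : ∀ t ∈ 𝔪, ∃ e : ℤ, HeckeRing0.toEnd L 2 t g = ((2 * e : ℤ) : ℂ) • g) :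
    ∃ γ : Gamma0 L, periodFunctional L ⟨iotaConj (γ : SL(2, ℤ)), iotaConj_coe_mem_gamma0 γ⟩ + periodFunctional L γ ∉
      𝔪 • periodHomologyHecke L := by
  obtain ⟨LW, hLW⟩ := exists_isNeronLatticeOf W
  obtain ⟨α, m, hα, hm, hWB, hBW⟩ := exists_real_oddIndex_latticeBridge_of_goodSS_two W A hss ψ hcyc hLW hLA
  have hc' : (c : ℝ) ≠ 0 := by exact_mod_cast hc
  refine exists_periodFunctional_iotaConj_add_notMem_of_latticeBridge W hΔ hLW g hreal 𝔪 h𝔪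
    LA.lattice.toAddSubgroup hc' (fun z ↦ ?_) hα hm (fun z hz ↦ hWB z hz) (fun b hb ↦ hBW b hb)
  rw [Submodule.mem_toAddSubgroup, hlat z, Complex.ofReal_ratCast]

/-- The `𝔪 • ⊤` spelling. [cite: CremonaAlgorithms1997, §2.10 (pp. 29–30)] -/
theorem exists_periodFunctional_iotaConj_add_notMem_top_of_optimalQuotient (W : WeierstrassCurve ℚ) [W.IsElliptic]
    [W.IsGloballyMinimal] (hss : GoodSS W 2) (hΔ : W.Δ < 0) {L : ℕ} [NeZero L] (g : CuspForm (Gamma0 L) 2)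
    (hreal : ∀ n, (cuspCoeff g n).im = 0)
    (A : WeierstrassCurve ℚ) [A.IsElliptic] {LA : PeriodPair} (hLA : IsNeronLatticeOf (A.baseChange ℂ) LA)
    {c : ℚ} (hc : c ≠ 0) (hlat : ∀ z : ℂ, z ∈ LA.lattice ↔ ∃ w ∈ periodLattice g, z = (c : ℂ) * w)
    (ψ : Isogeny W A) (hcyc : ψ.IsCyclic)
    (𝔪 : Ideal (HeckeRing0 L 2)) (h𝔪 : ∀ t ∈ 𝔪, ∃ e : ℤ, HeckeRing0.toEnd L 2 t g = ((2 * e : ℤ) : ℂ) • g) :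
    ∃ γ : Gamma0 L, (⟨periodFunctional L ⟨iotaConj (γ : SL(2, ℤ)), iotaConj_coe_mem_gamma0 γ⟩ + periodFunctional L γ,
        add_mem ((mem_periodHomologyHecke L).mpr (periodFunctional_mem_periodHomology L _))
          ((mem_periodHomologyHecke L).mpr (periodFunctional_mem_periodHomology L γ))⟩ : periodHomologyHecke L) ∉
      𝔪 • (⊤ : Submodule (HeckeRing0 L 2) (periodHomologyHecke L)) := by
  obtain ⟨γ, hγ⟩ := exists_periodFunctional_iotaConj_add_notMem_of_optimalQuotient W hss hΔ g hreal A hLA hc hlat ψ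
    hcyc 𝔪 h𝔪
  refine ⟨γ, fun hmem ↦ hγ ?_⟩
  have := Submodule.mem_map_of_mem (f := (periodHomologyHecke L).subtype) hmem
  rwa [Submodule.map_smul'', Submodule.map_top, Submodule.range_subtype] at this

end Assembly

end Summit.BirchSwinnertonDyer.BirchSwinnertonDyer.Theorems.ThetaLayerLambdaCongruenceAtTwo

end
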